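import Summits.ResolutionOfSingularities.ResolutionOfSingularities.Theorems.FrobeniusLadderFInjectiveMacaulayficationDeformation
import Mathlib.RingTheory.Localization.AtPrime.Basic
import Mathlib.RingTheory.Localization.Submodule
import Mathlib.Algebra.CharP.Basic
import HarnessLib

/-!
# The stalk clause of the blow-up at a point of the exceptional divisor, by deformation

Support file for crux stmt-ResolutionOfSingularities-15315
(`FrobeniusLadder.FInjectiveMacaulayfication`, line `Sketch`, lead seat c4, cycle 5, wave 1):
stub `stub_onExceptionalDeform` of the §6 BLOW-UP GLUE (E6) package.

Geometric meaning. `A` is a chart ring `R[I/a]` of the blowing up `Bl_I(Spec R)` — a Noetherian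
domain of prime characteristic `p` — and `u = a/1 ≠ 0` cuts out the exceptional divisor `E = V(u)`
on the chart (`u` is a non-zero-divisor: the exceptional divisor is Cartier). Let `Q` be a prime of
`A` ON the exceptional divisor (`u ∈ Q`). If the local ring `A_Q/(u)` of `E` at `Q` satisfies the
per-stalk clause of the crux — every system of parameters (`d = dim` elements generating an ideal
with maximal radical) is a weakly regular sequence and generates a Frobenius closed ideal
(`y^(p^e) ∈ ((s)^[p^e]) ⇒ y ∈ (s)`), i.e. Cohen–Macaulay + F-injective in Fedder's ideal-theoretic
form — then the local ring `A_Q` of the blow-up satisfies the FULL stalk clause of the crux: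
it is a domain, and every system of parameters of `A_Q` is weakly regular and generates a Frobenius
closed ideal (`stub_onExceptionalDeform`).

Proof. `A_Q` is a Noetherian local domain of characteristic `p` (bookkeeping of instances; the
characteristic because `p · 1 = 0` is preserved by `algebraMap A A_Q` and `A_Q` is nontrivial).
Since `A → A_Q` is injective (`A` a domain), `u/1 ≠ 0` is a non-zero-divisor of `A_Q`, and
`u/1 ∈ 𝔪_{A_Q}` because `u ∈ Q`. Now apply the DEFORMATION engine E1
(`Deformation.cmfi_of_cmfi_quotient`, Fedder 1983, Thm. 3.4 (1), Cohen–Macaulay case) to the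
Noetherian local ring `A_Q` and its non-zero-divisor `u/1 ∈ 𝔪`: the clause for `A_Q/(u/1)` (the
hypothesis, verbatim) gives the clause for `A_Q`.

## References

* [Fedder1983] R. Fedder, *F-purity and rational singularity*, Trans. Amer. Math. Soc. 278 (1983)
  461–480, Thm. 3.4 (1).
-/

-- single-problem summit: the doubled namespace component is forced
set_option linter.dupNamespace false

namespace Summit.ResolutionOfSingularities.ResolutionOfSingularities.Theorems.FInjectiveMacaulayfication.OnExceptionalDeform

/-- **The stalk clause of the blow-up at a point of the exceptional divisor (E6 glue, deformation
step).** Let `A` be a Noetherian domain of prime characteristic `p`, `u ≠ 0` in `A`, and `Q` a prime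
ideal of `A` containing `u`. If `A_Q/(u)` satisfies the per-stalk clause of crux
`FInjectiveMacaulayfication` (every system of parameters is a weakly regular sequence and generates a
Frobenius closed ideal, inline form), then `A_Q` is a domain satisfying the same clause. This is
Fedder's deformation theorem (`Deformation.cmfi_of_cmfi_quotient`) applied to the Noetherian local
ring `A_Q` and the non-zero-divisor `u/1 ∈ 𝔪_{A_Q}` (`A → A_Q` is injective since `A` is a domain,
and `u ∈ Q`). [cite: Fedder1983, Thm. 3.4 (1)] -/
theorem stub_onExceptionalDeform : ∀ (p : ℕ) [Fact p.Prime] (A : Type) [CommRing A] [IsDomain A] [IsNoetherianRing A]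
    [CharP A p] (u : A), u ≠ 0 → ∀ (Q : Ideal A) [Q.IsPrime], u ∈ Q →
    (∀ d : ℕ, ringKrullDim (Localization.AtPrime Q ⧸ Ideal.span {algebraMap A (Localization.AtPrime Q) u}) = d →
      ∀ s : Fin d → Localization.AtPrime Q ⧸ Ideal.span {algebraMap A (Localization.AtPrime Q) u},
        (Ideal.span (Set.range s)).radical.IsMaximal →
          RingTheory.Sequence.IsWeaklyRegular
              (Localization.AtPrime Q ⧸ Ideal.span {algebraMap A (Localization.AtPrime Q) u}) (List.ofFn s) ∧
          ∀ y : Localization.AtPrime Q ⧸ Ideal.span {algebraMap A (Localization.AtPrime Q) u},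
            (∃ e : ℕ, y ^ p ^ e ∈ Ideal.span
              ((fun z : Localization.AtPrime Q ⧸ Ideal.span {algebraMap A (Localization.AtPrime Q) u} => z ^ p ^ e) ''
                (Ideal.span (Set.range s) :
                  Set (Localization.AtPrime Q ⧸ Ideal.span {algebraMap A (Localization.AtPrime Q) u})))) →
            y ∈ Ideal.span (Set.range s)) →
    IsDomain (Localization.AtPrime Q) ∧
      ∀ d : ℕ, ringKrullDim (Localization.AtPrime Q) = d → ∀ s : Fin d → Localization.AtPrime Q,
        (Ideal.span (Set.range s)).radical.IsMaximal →
          RingTheory.Sequence.IsWeaklyRegular (Localization.AtPrime Q) (List.ofFn s) ∧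
          ∀ y : Localization.AtPrime Q, (∃ e : ℕ, y ^ p ^ e ∈ Ideal.span
            ((fun z : Localization.AtPrime Q => z ^ p ^ e) ''
              (Ideal.span (Set.range s) : Set (Localization.AtPrime Q)))) → y ∈ Ideal.span (Set.range s) := by
  intro p _ A _ _ _ _ u hu Q _ huQ hquot
  -- `A_Q` has characteristic `p`: `p · 1 = 0` is preserved by `algebraMap`, and `A_Q` is nontrivial
  haveI : CharP (Localization.AtPrime Q) p := by
    have hp : (p : Localization.AtPrime Q) = 0 := by
      rw [← map_natCast (algebraMap A (Localization.AtPrime Q)) p, CharP.cast_eq_zero, map_zero]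
    exact (CharP.charP_iff_prime_eq_zero Fact.out).mpr hp
  -- `u/1 ∈ 𝔪_{A_Q}` since `u ∈ Q`
  have hmax : algebraMap A (Localization.AtPrime Q) u ∈
      IsLocalRing.maximalIdeal (Localization.AtPrime Q) :=
    (IsLocalization.AtPrime.to_map_mem_maximal_iff (Localization.AtPrime Q) Q u).mpr huQ
  -- `u/1 ≠ 0` is a non-zero-divisor of the domain `A_Q` (`A → A_Q` injective)
  have hinj : Function.Injective (algebraMap A (Localization.AtPrime Q)) :=
    IsLocalization.injective (Localization.AtPrime Q) Q.primeCompl_le_nonZeroDivisors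
  have hnzd : algebraMap A (Localization.AtPrime Q) u ∈ nonZeroDivisors (Localization.AtPrime Q) :=
    mem_nonZeroDivisors_of_ne_zero ((map_ne_zero_iff _ hinj).mpr hu)
  -- deformation (Fedder 1983, Thm. 3.4 (1))
  exact ⟨inferInstance, Deformation.cmfi_of_cmfi_quotient p (Localization.AtPrime Q)
    (algebraMap A (Localization.AtPrime Q) u) hmax hnzd hquot⟩

end Summit.ResolutionOfSingularities.ResolutionOfSingularities.Theorems.FInjectiveMacaulayfication.OnExceptionalDeform
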